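import Literature.NumberTheory.Automorphic.Liu2021.AppendixC.HeckeEndomorphismTransposedWord
import Literature.NumberTheory.Automorphic.Liu2021.AppendixC.HeckeEndomorphismTransposedWordSinglePiece
import HarnessLib

/-!
# Liu 2021, Appendix C/D glue — the transposed Hecke word through ONE chosen piece per entry: the scalar assembly

[cite: Liu2021, p. 133 (before (D.3)): `ℍ_K ⊆ End(A_K)_ℚ` is the image of `C_c^∞(K\G(𝔸_F^∞)/K, ℚ) → End(A_K)_ℚ` induced by the Hecke
actions; §4.2 (FJcycle.tex l. 2070–2074)] [cite: Bump1997, §4.2 (Prop. 4.2.3: the double-coset operator `[KgK]` as a sum of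
translates over `KgK/K`, coset counting)] [cite: MumfordAV1970, §19 (Hom(X,Y) first paragraph; Thm. 3: `End⁰ = ℚ ⊗ End`)]

PROOF lane; sequel of ★ `HeckeEndomorphismTransposedWord` ((hx)/(hxd) junction of the d6 `stub_RosH` glue: the (hxd-brick)
`algEquiv_symm_endAlgebraBaseChange_heckeEnd_eq_smul_fan_sum_single`, ONE Hecke endomorphism `[KγK]` through ONE translate at a
normal level as a rational multiple of the FULL fan word over all pieces `c‴` of the deeper level) and of ★
`HeckeEndomorphismTransposedWordSinglePiece` (orbit–stabiliser bookkeeping `card_smul_sum_section_smul_eq_smul_sum` and the deck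
invariance of the entries `fan_entry_deck_invariant`, «the block is independent of the chosen `c‴`»).  Here the two are ASSEMBLED:
with ONE CHOSEN piece `ch c′` over each piece `c′` downstairs and the stabiliser weights equalised to `D` (`m c′ * #Stab(ch c′) = D`),

  `e⁻¹ (([KγK])_L) = ((#(KγK/K) / #ι) * (#Δ / D)) •`
    `(1 ⊗ Σ_{c′} πY_K (b (ch c′)) ≫ ((m c′ : ℤ) • (tt (ch c′) ≫ Nm_{tp (ch c′)})) ≫ ιY_K (φ (ch c′)))`

with the scalar non-zero — exactly the per-translate input `hx j` (`q j ≠ 0`) of ★ `algEquiv_symm_endAlgebraBaseChange_sum_smul`, whose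
sum over the translates `γ⁻¹` of `[KgK]` is the letter `hxd` of the d6 frame's `slot_letters` in the WEIGHTED currency of ★
`AbelianVariety.levelAdjoint_fan_sum_weighted` (entries `b i := b (ch c′)`, `g i := tt (ch c′) ≫ Nm_{tp (ch c′)}`, `a i := φ (ch c′)`).

* §1 `zsmul_fan_entry`, `endAlgebra_of_sum_eq_smul_of_sum_section` — pure bookkeeping: the integer weight moves inside the fan entry,
  and `1 ⊗ Σ_{c‴} E c‴ = (#Δ / D) • (1 ⊗ Σ_{c′} (m c′ : ℤ) • E (ch c′))` in `End⁰(Y_K)` for a deck-invariant `End(Y_K)`-valued family.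
* §2 `algEquiv_symm_endAlgebraBaseChange_heckeEnd_eq_smul_fan_sum_section` (+ `heckeEnd_section_scalar_ne_zero`) — the assembled
  per-translate identity above and the non-vanishing of its scalar.

All model data (pieces, Jacobians, fans, comparison isogenies, piece maps, trace words, deck transformations, the section `ch`) are
HYPOTHESES, as in ★ `HeckeEndomorphismComplexWord`; no definition, no instance, no named fact, no `sorry`.
-/

open CategoryTheory CategoryTheory.Limits AlgebraicGeometry MonoidalCategory CartesianMonoidalCategory NumberField Function MulAction
open Literature.AlgebraicGeometry.Motives

/-! ## §1 Bookkeeping in `End(Y_K)` and `End⁰(Y_K)` -/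

namespace Literature.NumberTheory.Automorphic.Liu2021.AppendixC

open AbelianVariety (bcSpec bcFunctor endAlgebra rationalTateModuleMap endAlgebraBaseChange)

universe u

/-- **The integer weight moves inside the fan entry**: `(m : ℤ) • (π_b ≫ g ≫ ι_a) = π_b ≫ ((m : ℤ) • g) ≫ ι_a` (bilinearity of composition,
Mathlib `Preadditive.zsmul_comp` / `Preadditive.comp_zsmul`). [cite: MumfordAV1970, §19 (Hom(X,Y), first paragraph)] -/
theorem zsmul_fan_entry {L : Type u} [Field L] {Y J₁ J₂ : AbelianVariety L} (π : Y ⟶ J₁) (g : J₁ ⟶ J₂) (ι : J₂ ⟶ Y) (m : ℤ) :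
    m • (π ≫ g ≫ ι) = π ≫ (m • g) ≫ ι := by
  rw [Preadditive.zsmul_comp, Preadditive.comp_zsmul]

/-- **One representative per fibre, in `End⁰(Y_K)`**: for a finite group `Δ` acting on the finite set `C″` with orbits the fibres of
`r : C″ → C′`, a section `ch` of `r`, a `Δ`-invariant family `E : C″ → End(Y_K)` and weights `m c′ * #Stab_Δ(ch c′) = D ≠ 0`,
`1 ⊗ Σ_{c‴} E c‴ = (#Δ / D) • (1 ⊗ Σ_{c′} (m c′ : ℤ) • E (ch c′))` in `End⁰(Y_K) = ℚ ⊗ End(Y_K)` —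
★ `card_smul_sum_section_smul_eq_smul_sum` (`#Δ • Σ_{c′} m c′ • E (ch c′) = D • Σ_{c‴} E c‴`, no divisibility hypothesis) pushed along
`endAlgebra.of` and divided by `D`.
[cite: Bump1997, §4.2 (Prop. 4.2.3: coset counting for double-coset operators)] [cite: MumfordAV1970, §19 Thm. 3] -/
theorem endAlgebra_of_sum_eq_smul_of_sum_section {L : Type u} [Field L] {Δ : Type*} [Group Δ] [Fintype Δ] {C'' C' : Type*}
    [Fintype C''] [DecidableEq C''] [Fintype C'] [DecidableEq C'] [MulAction Δ C''] (YK : AbelianVariety L)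
    (r : C'' → C') (hr : ∀ (d : Δ) (c : C''), r (d • c) = r c) (htrans : ∀ c₁ c₂ : C'', r c₁ = r c₂ → ∃ d : Δ, d • c₁ = c₂)
    (ch : C' → C'') (hch : ∀ c', r (ch c') = c') (E : C'' → End YK) (hE : ∀ (d : Δ) (c : C''), E (d • c) = E c)
    (m : C' → ℕ) {D : ℕ} (hD0 : D ≠ 0) (hm : ∀ c', m c' * Fintype.card (stabilizer Δ (ch c')) = D) :
    endAlgebra.of YK (∑ c, E c) = ((Fintype.card Δ : ℚ) / D) • endAlgebra.of YK (∑ c', (m c' : ℤ) • E (ch c')) := by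
  have H := Literature.NumberTheory.Automorphic.card_smul_sum_section_smul_eq_smul_sum r hr htrans ch hch E hE m hm
  have H' := congrArg (endAlgebra.of YK) H
  rw [map_nsmul, map_nsmul, ← Nat.cast_smul_eq_nsmul ℚ, ← Nat.cast_smul_eq_nsmul ℚ (D : ℕ)] at H'
  have hS : ∑ c', (m c' : ℤ) • E (ch c') = ∑ c', m c' • E (ch c') :=
    Finset.sum_congr rfl fun c' _ => natCast_zsmul _ _
  have hD0' : (D : ℚ) ≠ 0 := Nat.cast_ne_zero.mpr hD0
  rw [hS, div_eq_inv_mul, mul_smul, H', inv_smul_smul₀ hD0']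

-- `(A.baseChange L).X` is `(bcFunctor E L).obj A.X` only up to unfolding `AbelianVariety.baseChange` (as in ★ `HeckeEndomorphismComplexWord`)
set_option backward.isDefEq.respectTransparency false

variable {F E : Type} [Field F] [NumberField F] [IsTotallyReal F] [Field E] [NumberField E] [Algebra F E]
  [IsTotallyComplex E] [Algebra.IsQuadraticExtension F E]
variable {P5 : PropC5Data F E} {isotropicAt : ℕ → Prop}

namespace Sec42Data.HeckeTranslates

variable {C : Sec42Data P5 isotropicAt} (T : C.HeckeTranslates) (L : Type) [Field L] [Algebra E L]
variable {N K : C5.SmallLevel C.S.K₀}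
-- piecewise model of `A_N ⊗ L` (the deeper, normal level — `N″_γ` in the glue), with its fan `πN/ιN`
variable {CN : Type} [Fintype CN] [DecidableEq CN] (EN : CN → SchemeOver L) (eN : ∀ c, EN c ⟶ (bcFunctor E L).obj (C.X N))
  (JN : ∀ c, Jacobian (EN c)) (YN : AbelianVariety L) (πN : ∀ c, YN ⟶ (JN c).J) (ιN : ∀ c, (JN c).J ⟶ YN)
  (vN : YN ⟶ (C.A N).baseChange L) (lN : ∀ c, EN c ⊗ EN c ⟶ (bcFunctor E L).obj (C.alb N).nabla.N)
-- piecewise model of `A_K ⊗ L`, with its fan `πK/ιK`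
variable {CK : Type} (EK : CK → SchemeOver L) (eK : ∀ c, EK c ⟶ (bcFunctor E L).obj (C.X K))
  (JK : ∀ c, Jacobian (EK c)) (YK : AbelianVariety L) (πK : ∀ c, YK ⟶ (JK c).J) (ιK : ∀ c, (JK c).J ⟶ YK)
  (vK : YK ⟶ (C.A K).baseChange L) (lK : ∀ c, EK c ⊗ EK c ⟶ (bcFunctor E L).obj (C.alb K).nabla.N)

/-! ## §2 One translate at a normal level, one chosen piece per entry: the scalar assembly -/

/-- **The scalar is non-zero**: `(#(KγK/K) / #ι) * (#Δ / D) ≠ 0` (the orbit is finite and contains `γK`; `ι`, `Δ` non-empty; `D ≠ 0`) —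
the side condition `q j ≠ 0` of ★ `algEquiv_symm_endAlgebraBaseChange_sum_smul`. [cite: Bump1997, §4.2 (Prop. 4.2.3)] -/
theorem heckeEnd_section_scalar_ne_zero (K : C5.SmallLevel C.S.K₀) (γ : C.G) {ι : Type*} [Fintype ι] [Nonempty ι]
    {Δ : Type*} [Group Δ] [Fintype Δ] {D : ℕ} (hD0 : D ≠ 0)
    (hfin : (orbit K.1.1 (γ : C.G ⧸ (K.1.1 : Subgroup C.G))).Finite) :
    ((((orbit K.1.1 (γ : C.G ⧸ (K.1.1 : Subgroup C.G))).ncard : ℚ) / Fintype.card ι) * ((Fintype.card Δ : ℚ) / D)) ≠ 0 := by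
  have hι : (Fintype.card ι : ℚ) ≠ 0 := Nat.cast_ne_zero.mpr Fintype.card_ne_zero
  have h0 : ((orbit K.1.1 (γ : C.G ⧸ (K.1.1 : Subgroup C.G))).ncard : ℚ) ≠ 0 :=
    Nat.cast_ne_zero.mpr ((Set.ncard_pos hfin).mpr ⟨_, mem_orbit_self _⟩).ne'
  have hΔ : (Fintype.card Δ : ℚ) ≠ 0 := Nat.cast_ne_zero.mpr Fintype.card_ne_zero
  have hD0' : (D : ℚ) ≠ 0 := Nat.cast_ne_zero.mpr hD0
  exact mul_ne_zero (div_ne_zero h0 hι) (div_ne_zero hΔ hD0')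

section Section

variable (htotN : ∑ c, πN c ≫ ιN c = 𝟙 YN)
  (hιπN : ∀ c, ιN c ≫ πN c = 𝟙 (JN c).J) (hιπN' : ∀ c₁ c₂, c₁ ≠ c₂ → ιN c₁ ≫ πN c₂ = 0)
  (hlN : ∀ c, lN c ≫ (bcFunctor E L).map (C.alb N).nabla.incl = (eN c ⊗ₘ eN c) ≫ Functor.LaxMonoidal.μ (bcFunctor E L) (C.X N) (C.X N))
  (hlαN : ∀ c, lN c ≫ (bcFunctor E L).map (C.alb N).α = (JN c).diff ≫ (ιN c ≫ vN).hom.hom.hom)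
  (hlK : ∀ c, lK c ≫ (bcFunctor E L).map (C.alb K).nabla.incl = (eK c ⊗ₘ eK c) ≫ Functor.LaxMonoidal.μ (bcFunctor E L) (C.X K) (C.X K))
  (hlαK : ∀ c, lK c ≫ (bcFunctor E L).map (C.alb K).α = (JK c).diff ≫ (ιK c ≫ vK).hom.hom.hom)
  (γ : C.G) (hγ : C5.HeckeLE γ N K) (φ : CN → CK) (tp : ∀ c', EN c' ⟶ EK (φ c'))
  (htp : ∀ c', tp c' ≫ eK (φ c') = eN c' ≫ (bcFunctor E L).map (T.tr γ N K hγ))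
  (t : C.A K ⟶ C.A N) (bN : CN → CK) (tt : ∀ c', (JK (bN c')).J ⟶ (JN c').J)
  (hWt : (∑ c', πK (bN c') ≫ tt c' ≫ ιN c') ≫ vN = vK ≫ AbelianVariety.Hom.baseChange L t)
  -- deck transformations of the normal level: a finite group `Δ` permuting the pieces of `X_N ⊗ L` through ambient automorphisms
  -- `Tκ d` (fixing the translate `T_γ`), with piece isomorphisms `dk d c` over them; the trace word is deck invariant at the Y-level
  {Δ : Type*} [Group Δ] [Fintype Δ] [MulAction Δ CN] (Tκ : Δ → ((bcFunctor E L).obj (C.X N) ⟶ (bcFunctor E L).obj (C.X N)))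
  (dk : ∀ (d : Δ) (c : CN), EN c ⟶ EN (d • c))
  (hdk : ∀ (d : Δ) (c : CN), dk d c ≫ eN (d • c) = eN c ≫ Tκ d)
  (hκ : ∀ d : Δ, Tκ d ≫ (bcFunctor E L).map (T.tr γ N K hγ) = (bcFunctor E L).map (T.tr γ N K hγ))
  (hφ : ∀ (d : Δ) (c : CN), φ (d • c) = φ c)
  (hWd : ∀ d : Δ, (∑ c, πK (bN c) ≫ tt c ≫ ιN c) ≫ (∑ c, πN c ≫ (JN c).pushforward (JN (d • c)) (dk d c) ≫ ιN (d • c)) =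
    ∑ c, πK (bN c) ≫ tt c ≫ ιN c)
  -- one chosen piece `ch c′` of `X_N ⊗ L` over each piece `c′` downstairs (`r` = the piece map of the Galois cover, `Δ` transitive on
  -- its fibres), stabiliser weights equalised to `D`
  {C' : Type*} [Fintype C'] [DecidableEq C'] (r : CN → C') (hr : ∀ (d : Δ) (c : CN), r (d • c) = r c)
  (htrans : ∀ c₁ c₂ : CN, r c₁ = r c₂ → ∃ d : Δ, d • c₁ = c₂) (ch : C' → CN) (hch : ∀ c', r (ch c') = c')
  (m : C' → ℕ) {D : ℕ} (hD0 : D ≠ 0) (hm : ∀ c', m c' * Fintype.card (stabilizer Δ (ch c')) = D)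

include htotN hιπN hιπN' hlN hlαN hlK hlαK htp hWt hdk hκ hφ hWd hr htrans hch hD0 hm in
/-- **(hxd) PER TRANSLATE, ONE CHOSEN PIECE PER ENTRY — THE SCALAR ASSEMBLY.**  With `t` the trace of the normal level cover
`X_N → X_K` (pinned by `Alb_u ≫ t = Σ_i Alb T_{δ_i}`), ONE translate `T_γ : X_N → X_K` with piece maps `(φ, tp)`, the trace word in matrix
form `(bN, tt)`, a finite group `Δ` of deck transformations of `X_N ⊗ L` fixing `T_γ` and permuting the pieces transitively along the
fibres of `r : C_N → C′`, a section `ch` of `r` and weights `m c′ * #Stab_Δ(ch c′) = D ≠ 0`: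
`e⁻¹ (([KγK])_L) = ((#(KγK/K) / #ι) * (#Δ / D)) •`
`(1 ⊗ Σ_{c′} πY_K (bN (ch c′)) ≫ ((m c′ : ℤ) • (tt (ch c′) ≫ Nm_{tp (ch c′)})) ≫ ιY_K (φ (ch c′)))`
— ★ (hxd-brick) `algEquiv_symm_endAlgebraBaseChange_heckeEnd_eq_smul_fan_sum_single` (the full word over all `c‴`), ★
`fan_entry_deck_invariant` (the entries are deck invariant) and `endAlgebra_of_sum_eq_smul_of_sum_section` (orbit–stabiliser).  The d6
glue applies it at `(γ⁻¹, N″_γ, K)` for each translate `γ` of `[KgK]`; it is the input `hx j` of ★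
`algEquiv_symm_endAlgebraBaseChange_sum_smul`.
[cite: Liu2021, p. 133 (before (D.3)) and §4.2 (FJcycle.tex l. 2074)] [cite: Bump1997, §4.2 (Prop. 4.2.3)] [cite: MumfordAV1970, §19 Thm. 3] -/
theorem algEquiv_symm_endAlgebraBaseChange_heckeEnd_eq_smul_fan_sum_section [∀ c, Mono (eK c)] (ℓ : ℕ) [Fact ℓ.Prime]
    (hD : T.IsogenyDescent)
    (hI : ∀ ⦃K K' : C5.SmallLevel C.S.K₀⦄ (f : K' ⟶ K), Function.Injective (rationalTateModuleMap ℓ (C.Atr f)).dualMap)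
    (h : N ≤ K) (hn : ∀ k ∈ K.1.1, C5.HeckeLE k N N)
    {ι : Type*} [Fintype ι] [Nonempty ι] (δ : ι → C.G) (hδ : ∀ i, δ i ∈ K.1.1)
    (hsurjN : ∀ k ∈ K.1.1, ∃ i, (δ i)⁻¹ * k ∈ N.1.1) (hinjN : ∀ i j, (δ i)⁻¹ * δ j ∈ N.1.1 → i = j)
    (ht : C.Atr (homOfLE h) ≫ t = ∑ i, T.albTr (δ i) N N (hn _ (hδ i)))
    (hfin : (orbit K.1.1 (γ : C.G ⧸ (K.1.1 : Subgroup C.G))).Finite)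
    (e : YK.endAlgebra ≃ₐ[ℚ] ((C.A K).baseChange L).endAlgebra)
    (he : ∀ (ψ : End YK) (φ' : End ((C.A K).baseChange L)), End.asHom ψ ≫ vK = vK ≫ End.asHom φ' →
      e (endAlgebra.of YK ψ) = endAlgebra.of ((C.A K).baseChange L) φ') :
    e.symm (endAlgebraBaseChange L (C.A K) (T.heckeEnd hD K γ)) =
      ((((orbit K.1.1 (γ : C.G ⧸ (K.1.1 : Subgroup C.G))).ncard : ℚ) / Fintype.card ι) * ((Fintype.card Δ : ℚ) / D)) •
        endAlgebra.of YK (∑ c', πK (bN (ch c')) ≫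
          ((m c' : ℤ) • (tt (ch c') ≫ (JN (ch c')).pushforward (JK (φ (ch c'))) (tp (ch c')))) ≫ ιK (φ (ch c'))) := by
  -- the entries are deck invariant («the block is independent of the chosen `c‴`»)
  have hE : ∀ (d : Δ) (c : CN),
      πK (bN (d • c)) ≫ (tt (d • c) ≫ (JN (d • c)).pushforward (JK (φ (d • c))) (tp (d • c))) ≫ ιK (φ (d • c)) =
        πK (bN c) ≫ (tt c ≫ (JN c).pushforward (JK (φ c)) (tp c)) ≫ ιK (φ c) := fun d c =>
    fan_entry_deck_invariant EN eN JN YN πN ιN EK eK JK YK πK ιK Tκ dk ((bcFunctor E L).map (T.tr γ N K hγ)) φ tp bN tt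
      hιπN hιπN' hdk hκ htp hφ hWd d c
  -- the brick: the full word over all pieces of `X_N ⊗ L`
  rw [T.algEquiv_symm_endAlgebraBaseChange_heckeEnd_eq_smul_fan_sum_single L EN eN JN YN πN ιN vN lN EK eK JK YK πK ιK vK lK htotN
      hιπN hιπN' hlN hlαN hlK hlαK γ hγ φ tp htp t bN tt hWt ℓ hD hI h hn δ hδ hsurjN hinjN ht hfin e he,
    -- orbit–stabiliser bookkeeping in `End⁰(Y_K)`
    endAlgebra_of_sum_eq_smul_of_sum_section YK r hr htrans ch hch
      (fun c => πK (bN c) ≫ (tt c ≫ (JN c).pushforward (JK (φ c)) (tp c)) ≫ ιK (φ c)) hE m hD0 hm,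
    smul_smul]
  -- the integer weights move inside the entries
  congr 2
  exact Finset.sum_congr rfl fun c' _ => zsmul_fan_entry _ _ _ _

end Section

end Sec42Data.HeckeTranslates

end Literature.NumberTheory.Automorphic.Liu2021.AppendixC
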